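import Literature.Computability.AlgebraicComplexity.HwvIdealRankBound
import Literature.Computability.AlgebraicComplexity.PlethysmStability
import HarnessLib

/-!
# Equations of an orbit closure propagate: products of highest-weight equations with
# highest-weight vectors

Topic `Literature/Computability/AlgebraicComplexity`; companion of `HwvIdealRankBound.lean`
(`mult_χ k[Δ_m[f]] + dim (HWV_χ ∩ I(GL·f)) = a_χ`) and `PlethysmStability.lean`
(`mul_mem_highestWeightSpace_coordRep`: `GL` acts on `k[Sym^m]` by algebra automorphisms, so
highest-weight vectors multiply and weights add — Bürgisser–Ikenmeyer–Panova, J. AMS 32 (2019),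
§5(c)).  Honest framing of the cell served (`pub-gct`, papers/PneNP/gct-obstructions): rung-1
multiplicity-obstruction search for permanent versus determinant at small `(n, m)`; no claim
about VP ≠ VNP or P ≠ NP.

**The fact.** The vanishing ideal `I(GL · f) ⊆ k[Sym^m (k^σ)]` is an ideal and a graded
`GL`-subrepresentation (Bürgisser–Ikenmeyer 2013, proof of Prop. 3.3). Hence if `F` is a
highest-weight EQUATION of `Δ_m[f]` of weight `χ` (a nonzero highest-weight vector in `I(GL·f)`)
and `G` is any nonzero highest-weight vector of weight `ψ`, then `F · G` is a highest-weight
equation of weight `χ + ψ`.  In multiplicity language: the set of "dropping" types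
`{χ : mult_χ k[Δ_m[f]] < a_χ}` is closed under adding occurring types `ψ` (`a_ψ ≥ 1`).  For the
determinant this turns every `sk`-detected equation type `λ*` in degree `d`
(`sk(λ, m×d) < a_λ`, Bürgisser–Ikenmeyer 2013 (5.2); Ikenmeyer 2012 App. A.1) into equation
types `λ* + ψ` in every higher degree — a printed-theorem-level source of equations of
`Δ(det_m)` beyond the count `a − sk` of a given degree, used by the cell to sort its degree-12
det-side deficits `r_det < sk` into "product-explained" and "new-generator candidate" types
(Landsberg–Manivel–Ressayre 2013 §2–3 exhibit one generator type of degree 12 for `m = 3` and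
expect more).  No definitions, no named facts.

## References

* P. Bürgisser, C. Ikenmeyer, G. Panova, *No occurrence obstructions in geometric complexity
  theory*, J. Amer. Math. Soc. 32 (2019), §5(c). [BurgisserIkenmeyerPanovaJAMS2019]
* P. Bürgisser, C. Ikenmeyer, *Explicit lower bounds via geometric complexity theory*, STOC 2013
  = arXiv:1210.8368, §3.3 Prop. 3.3 and §5 (5.1)–(5.2). [BurgisserIkenmeyer2013]
* J. M. Landsberg, L. Manivel, N. Ressayre, *Hypersurfaces with degenerate duals and the geometric
  complexity theory program*, Comment. Math. Helv. 88 (2013) 469–484, Thm. 2.3.1 and §3.2.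
  [LandsbergManivelRessayre2013]

## Mathlib and tree

Tree: `mul_mem_highestWeightSpace_coordRep` (`PlethysmStability.lean`),
`orbitMultiplicity_add_finrank_inf_eq_plethysmCoeff`, `orbitMultiplicity_lt_plethysmCoeff_of_mem_orbitVanishingIdeal`,
`exists_hwv_mem_orbitVanishingIdeal_det_of_symKroneckerCoeffRect_lt` (`HwvIdealRankBound.lean`),
`plethysmCoeff`, `hwMultiplicity` (`SchurWeylPlethysm.lean`, `GLHighestWeight.lean`).
-/

noncomputable section

namespace Literature.Computability.AlgebraicComplexity

open _root_.Literature.NumberTheory.DiophantineGeometry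

section General

variable {σ : Type*} [Fintype σ] [LinearOrder σ] {k : Type*} [Field k]

/-- **A highest-weight equation times a highest-weight vector is a highest-weight equation** of the
summed weight: `F ∈ HWV_χ ∩ I(GL · f)`, `G ∈ HWV_ψ` give `F·G ∈ HWV_{χ+ψ} ∩ I(GL · f)`
(`GL` acts by algebra automorphisms, BIP19 §5(c); `I(GL·f)` is an ideal).
[cite: BurgisserIkenmeyerPanovaJAMS2019, §5(c)] -/
theorem mul_mem_hwv_inf_orbitVanishingIdeal {f : MvPolynomial σ k} {m : ℕ} {χ ψ : Weight σ}
    {F G : MvPolynomial (DegIdx σ m) k} (hF : F ∈ highestWeightSpace (coordRep σ k m) χ)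
    (hFI : F ∈ orbitVanishingIdeal f m) (hG : G ∈ highestWeightSpace (coordRep σ k m) ψ) :
    F * G ∈ highestWeightSpace (coordRep σ k m) (χ + ψ) ∧ F * G ∈ orbitVanishingIdeal f m :=
  ⟨mul_mem_highestWeightSpace_coordRep hF hG, Ideal.mul_mem_right G _ hFI⟩

/-- A positive plethysm coefficient is carried by a nonzero highest-weight vector of `k[Sym^m]`
(`a_ψ = dim HWV_ψ`). [folklore] -/
theorem exists_hwv_ne_zero_of_plethysmCoeff_pos {m : ℕ} {ψ : Weight σ}
    (hψ : 1 ≤ plethysmCoeff k σ m ψ) :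
    ∃ G : MvPolynomial (DegIdx σ m) k, G ≠ 0 ∧ G ∈ highestWeightSpace (coordRep σ k m) ψ := by
  have hpos : 0 < Module.finrank k ↥(highestWeightSpace (coordRep σ k m) ψ) := hψ
  haveI := Module.nontrivial_of_finrank_pos hpos
  obtain ⟨⟨G, hG⟩, hG0⟩ := exists_ne (0 : ↥(highestWeightSpace (coordRep σ k m) ψ))
  exact ⟨G, fun h => hG0 (Subtype.ext h), hG⟩

/-- **Dropping types are closed under adding occurring types.** For a form `f`, `m ≠ 0`,
characteristic zero: if `mult_χ k[Δ_m[f]] < a_χ` (some highest-weight equation of weight `χ`,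
by rank–nullity) and `a_ψ ≥ 1`, then there is a nonzero highest-weight equation of weight
`χ + ψ`. [cite: BurgisserIkenmeyer2013, §3.3 Prop. 3.3] -/
theorem exists_hwv_mem_orbitVanishingIdeal_add [CharZero k] {f : MvPolynomial σ k} {m : ℕ}
    (hm : m ≠ 0) {χ ψ : Weight σ} (hχ : orbitMultiplicity k f m χ < plethysmCoeff k σ m χ)
    (hψ : 1 ≤ plethysmCoeff k σ m ψ) :
    ∃ H : MvPolynomial (DegIdx σ m) k, H ≠ 0 ∧
      H ∈ highestWeightSpace (coordRep σ k m) (χ + ψ) ∧ H ∈ orbitVanishingIdeal f m := by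
  have hrn := orbitMultiplicity_add_finrank_inf_eq_plethysmCoeff (k := k) f hm χ
  have hpos : 0 < Module.finrank k ↥(highestWeightSpace (coordRep σ k m) χ ⊓
      (orbitVanishingIdeal f m).restrictScalars k) := by omega
  haveI := Module.nontrivial_of_finrank_pos hpos
  obtain ⟨⟨F, hFH, hFI⟩, hF0⟩ := exists_ne (0 : ↥(highestWeightSpace (coordRep σ k m) χ ⊓
      (orbitVanishingIdeal f m).restrictScalars k))
  obtain ⟨G, hG0, hG⟩ := exists_hwv_ne_zero_of_plethysmCoeff_pos (k := k) hψ
  obtain ⟨hH, hHI⟩ := mul_mem_hwv_inf_orbitVanishingIdeal (f := f) hFH hFI hG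
  exact ⟨F * G, mul_ne_zero (fun h => hF0 (Subtype.ext h)) hG0, hH, hHI⟩

/-- **Multiplicity form**: `mult_χ k[Δ_m[f]] < a_χ` and `a_ψ ≥ 1` imply
`mult_{χ+ψ} k[Δ_m[f]] < a_{χ+ψ}` (`m ≠ 0`, characteristic zero) — an equation type in one degree
forces equation types in every higher degree. [cite: BurgisserIkenmeyer2013, §3.3 Prop. 3.3] -/
theorem orbitMultiplicity_add_lt_plethysmCoeff [CharZero k] {f : MvPolynomial σ k} {m : ℕ}
    (hm : m ≠ 0) {χ ψ : Weight σ} (hχ : orbitMultiplicity k f m χ < plethysmCoeff k σ m χ)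
    (hψ : 1 ≤ plethysmCoeff k σ m ψ) :
    orbitMultiplicity k f m (χ + ψ) < plethysmCoeff k σ m (χ + ψ) := by
  obtain ⟨H, hH0, hH, hHI⟩ := exists_hwv_mem_orbitVanishingIdeal_add hm hχ hψ
  exact orbitMultiplicity_lt_plethysmCoeff_of_mem_orbitVanishingIdeal hm hH hHI hH0

end General

/-! ### Determinant: `sk`-detected equation types propagate to higher degrees -/

section Determinant

variable {k : Type} [Field k]

/-- **Propagation of `sk`-detected equations of `Δ(det_m)`.** If `ℓ(λ) ≤ m²` and
`sk(λ, m×d) < a_λ` (so `Δ(det_m)` has a highest-weight equation of weight `λ*` in degree `d`,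
Bürgisser–Ikenmeyer 2013 (5.2)) and `ψ` is any weight with `a_ψ ≥ 1` (e.g. `ψ = μ*` for an
occurring type `μ ⊢ m d'`), then `Δ(det_m)` has a highest-weight equation of weight `λ* + ψ`:
`mult_{λ*+ψ} k[Δ(det_m)] < a_{λ*+ψ}` — whether or not the orbit count `a − sk` of that degree
sees it. [cite: BurgisserIkenmeyer2013, §5 (5.2)] -/
theorem orbitMultiplicity_det_add_lt_plethysmCoeff [CharZero k] {m d : ℕ} [NeZero m]
    (lam : Nat.Partition (m * d)) (hlam : lam.parts.card ≤ m * m)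
    (hlt : symKroneckerCoeffRect k m d lam <
      plethysmCoeff k (MatIdx m) m (Weight.dualOfPartition (m * m) lam).toMatIdx)
    {ψ : Weight (MatIdx m)} (hψ : 1 ≤ plethysmCoeff k (MatIdx m) m ψ) :
    orbitMultiplicity k (detFormLex k m) m ((Weight.dualOfPartition (m * m) lam).toMatIdx + ψ) <
      plethysmCoeff k (MatIdx m) m ((Weight.dualOfPartition (m * m) lam).toMatIdx + ψ) := by
  obtain ⟨F, hF0, hF, hI⟩ :=
    exists_hwv_mem_orbitVanishingIdeal_det_of_symKroneckerCoeffRect_lt (k := k) lam hlam hlt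
  have hχ := orbitMultiplicity_lt_plethysmCoeff_of_mem_orbitVanishingIdeal (NeZero.ne m) hF hI hF0
  exact orbitMultiplicity_add_lt_plethysmCoeff (NeZero.ne m) hχ hψ

end Determinant

end Literature.Computability.AlgebraicComplexity
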